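import Summits.QuantumFields.BalabanUV.Beta.EriceRemainderEnclosureHistoryAutonomyComparisonAgeCompositionStaticChainSpikeFluid

/-!
# EriceRemainderEnclosureHistoryAutonomyComparisonAgeCompositionStaticChainFluidDomination — (E73a) FLUID DOMINATION (README `g63/e72` §7 (S2)) WITH THE
# ATOM CORRECTION: every discrete constant-coefficient spike chain is dominated, member by member, by ANY solution of the spike fluid
# `F' = F(a + θF)∕(D₀ − κ's)` with `κ' ≥ max(κ, a)` — and the existence of the fluid on `[0, X]` FORCES the discrete spike to close there

Cell `pub-balaban`, β-function sub-cell, BINDER row D4 «RemainderConst leaves for Bałaban's split» (`HOME/BINDER-OWNERS.md`; owner lineage `b2b-balaban-beta-an4`;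
this file by co-owner #2 lineage `b2b-balaban-beta-d4-p2`, generation 64), β-FLOW TEAM duty (1), FREEZE (0) honoured (def-free; imports (E72e)
`…StaticChainSpikeFluid` — and through it (E72a) `…StaticChain` — for `sum_rho_mul_compounding`, `hasDerivAt_spike_closed_form`, `spike_closed_form_zero`,
used BY NAME; nothing restated).

HONEST FRAMING (page 1, verbatim and binding).  *"Discharging BetaPertH makes Bałaban's UV stability UNCONDITIONAL — a real constructive-QFT result; it is
NOT the continuum limit and NOT the Clay problem."*  THIS FILE DISCHARGES NOTHING OF THE KIND.  Elementary real analysis (a Riccati-type monotonicity and the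
mean value theorem in the form `antitoneOn_of_deriv_nonpos` ∕ `monotoneOn_of_deriv_nonneg`) about the census's own FIRST-ORDER static chain over NOT-IN-PRINT
binders; the form, signs, ages and moments of Bałaban's (1.22) limit functional are NOT PRINTED ([I] p. 298; GAPS G-t4-U2-1∕-2) and NOT asserted.  Row D4 class
UNCHANGED (critical-path width 0; instance 0∕1; D4 DISCHARGE NO DATE).  HONEST DEPENDENCY: continuum YM on T⁴ ⇐ BetaPertH ∧ nine spine estimates (0/9 proved);
BetaPertH ⇐ (D1) ∧ (D4) ∧ CAP+tail; G-an2-4 gates asym, D1 and NE2/3/4.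

THE POINT (census sense (α); route (N); README `g63/e72` §5 «the spike fluid», §7 open statement (S2) «fluid domination»).  A DISCRETE SPIKE is a chain of
members `m = 0, 1, …` (oldest first) with loads `h_m ≥ 0`, consumed load `t_{m+1} = t_m + h_m`, compounding `E_{m+1} = E_m∕(1 − ρ_m)` and KEY ratios obeying
the constant-coefficient step inequality `ρ_m ≤ h_m·(a + θE_m)∕(D₀ − κt_m)` (§4 `spike_step_le`: this is what the static chain gives inside a dense cluster
— mutual defects `≤ θ_s`, mutual charges `≤ c` (`κ = √2c`), the incoming FAR load `Λ` COMPOUNDED by the older members exactly like every carried ratio, whence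
`a = 1 − θ_s`, `θ = θ_s + Λ`; README §5's display `1 + Λ + θ_s(E−1)` is the uncompounded variant `a = 1 − θ_s + Λ`, `θ = θ_s` — both are instances, the
letters `a, θ` here are abstract).  The SPIKE FLUID is any positive `F` on `[0, X]` with `F' = F·(a + θF)∕(D₀ − κ's)` ((E72e) certifies the closed form
`a·q∕(1−θq)`).  §1 RICCATI STRUCTURE: the inverse rate `(D₀ − κ's)∕(a + θF(s))` has derivative `−(κ' + θF)∕(a + θF) ≤ −1` iff **`κ' ≥ a`** (`hasDerivAt_inv_rate`),
so `s ↦ 1∕μ(s) + s` is non-increasing (`inv_rate_add_id_antitoneOn`); hence for `t ≤ s` in `[0, X]`: **`μ(t)·(s − t) < 1`** (`rate_mul_sub_lt_one` — a finite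
fluid cannot outlive `1∕μ`) and `μ(s)(1 − μ(t)(s−t)) ≥ μ(t)` (`rate_lower_bound`).  §2 ONE-STEP DOMINATION: `s ↦ F(s)·(1 − μ(t)(s − t))` is non-decreasing on
`[t, X]`, so **`F(s) ≥ F(t)∕(1 − μ(t)(s−t))`** (`fluid_step`) — the fluid over a member's load grows AT LEAST like one atom charged at the rate of the START of the
step, which is MORE than the discrete member (whose rate uses `E_m ≤ F(t_m)` and `κ ≤ κ'`).  §3 **`spike_le_fluid`**: by induction `0 < E_m ≤ F(t_m)` for every
`m ≤ M` with `t_M ≤ X`, AND `ρ_m < 1` for `m < M` — THE EXISTENCE OF THE FLUID UP TO THE CONSUMED LOAD FORCES THE DISCRETE SPIKE TO CLOSE (no separate closure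
hypothesis).  THE ATOM CORRECTION: the hypothesis is `κ' ≥ max(κ, a)` on the FLUID's slope only — a discrete spike with `κ < a` is dominated by the fluid with
the steeper denominator `κ' = a` (README §5's second-order criterion `√2c ≥ a` made global and unconditional); in the compounded bookkeeping `a = 1 − θ̄(1) =
0.214 < κ = √2·2(√2−1) = 1.17`, so for the worst-constant spike NO correction is needed and (S2) holds outright.  §4 `spike_step_le` (the step inequality from the
chain's structure, (E72a) `sum_rho_mul_compounding`), `compounding_succ`.  §5 **`spike_le_closed_form`**: §3 with (E72e)'s closed form — for `0 < a ≤ κ'`, `0 ≤ θ`,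
`κ ≤ κ'`, `D₀ − κ't_M > 0` and `θ·q(t_M) < 1`: `E_m ≤ a·q(t_m)∕(1 − θq(t_m))`, `q(t) = e^{(a∕κ')(log D₀ − log(D₀−κ't))}∕(a+θ)`, and `ρ_m < 1`, for all `m ≤ M`.
NUMERICS of record (g63 t38∕t39, no comb): the mean-coefficient fluid is 1–4 % above the discrete spike (z = 160) in `e, V, ρ, T`; the worst-constant fluid a
further 2–5 % above.  NOT CLAIMED: (S1) spike reduction; the near-window lemmas (NW-T)∕(NW-ρ); uniqueness of the fluid; MONO; anything nonlinear; anything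
printed.
-/
noncomputable section

open Set Finset

namespace Summit.QuantumFields.BalabanUV.Beta.EriceRemainderEnclosureHistoryAutonomyComparisonAgeCompositionStaticChainFluidDomination

open Summit.QuantumFields.BalabanUV.Beta.EriceRemainderEnclosureHistoryAutonomyComparisonAgeCompositionStaticChain (sum_rho_mul_compounding)
open Summit.QuantumFields.BalabanUV.Beta.EriceRemainderEnclosureHistoryAutonomyComparisonAgeCompositionStaticChainSpikeFluid
  (hasDerivAt_spike_closed_form spike_closed_form_zero)

/-! ## §1 The Riccati structure of the fluid's rate `μ(s) = (a + θF(s))∕(D₀ − κ's)` -/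

/-- **DERIVATIVE OF THE INVERSE RATE.**  Along a solution of `F' = F(a + θF)∕(D₀ − κ's)` the inverse rate `(D₀ − κ's)∕(a + θF(s))` has derivative
`−(κ' + θF(s))∕(a + θF(s))` — which is `≤ −1` exactly when `κ' ≥ a` (the Riccati inequality `μ' ≥ μ²`). [folklore] -/
theorem hasDerivAt_inv_rate {F : ℝ → ℝ} {a θ κ' D0 s : ℝ} (hpos : 0 < a + θ * F s) (hD : D0 - κ' * s ≠ 0)
    (hF : HasDerivAt F (F s * (a + θ * F s) / (D0 - κ' * s)) s) :
    HasDerivAt (fun u => (D0 - κ' * u) / (a + θ * F u)) (-(κ' + θ * F s) / (a + θ * F s)) s := by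
  have hnum : HasDerivAt (fun u : ℝ => D0 - κ' * u) (-κ') s := by
    simpa using ((hasDerivAt_id s).const_mul κ').const_sub D0
  have hden : HasDerivAt (fun u => a + θ * F u) (θ * (F s * (a + θ * F s) / (D0 - κ' * s))) s := by
    simpa using (hF.const_mul θ).const_add a
  have h := hnum.div hden hpos.ne'
  refine h.congr_deriv ?_
  have hp : a + θ * F s ≠ 0 := hpos.ne'
  rw [div_eq_div_iff (pow_ne_zero 2 hp) hp]
  field_simp
  ring

/-- **RICCATI MONOTONICITY.**  Along a positive-rate solution on `[0, X]` (`a + θF > 0`, `D₀ − κ's > 0`) with **`a ≤ κ'`**, the function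
`s ↦ (D₀ − κ's)∕(a + θF(s)) + s` («inverse rate plus time») is non-increasing on `[0, X]`. [folklore] -/
theorem inv_rate_add_id_antitoneOn {F : ℝ → ℝ} {a θ κ' D0 X : ℝ} (haκ : a ≤ κ')
    (hpos : ∀ s ∈ Icc (0:ℝ) X, 0 < a + θ * F s) (hD : ∀ s ∈ Icc (0:ℝ) X, 0 < D0 - κ' * s)
    (hF : ∀ s ∈ Icc (0:ℝ) X, HasDerivAt F (F s * (a + θ * F s) / (D0 - κ' * s)) s) :
    AntitoneOn (fun u => (D0 - κ' * u) / (a + θ * F u) + u) (Icc (0:ℝ) X) := by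
  have hderiv : ∀ s ∈ Icc (0:ℝ) X, HasDerivAt (fun u => (D0 - κ' * u) / (a + θ * F u) + u)
      (-(κ' + θ * F s) / (a + θ * F s) + 1) s := fun s hs =>
    (hasDerivAt_inv_rate (hpos s hs) (hD s hs).ne' (hF s hs)).add (hasDerivAt_id s)
  refine antitoneOn_of_deriv_nonpos (convex_Icc 0 X) ?_ ?_ ?_
  · exact fun s hs => (hderiv s hs).continuousAt.continuousWithinAt
  · rw [interior_Icc]
    exact fun s hs => (hderiv s (Ioo_subset_Icc_self hs)).differentiableAt.differentiableWithinAt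
  · rw [interior_Icc]
    intro s hs
    have hs' : s ∈ Icc (0:ℝ) X := Ioo_subset_Icc_self hs
    have hp := hpos s hs'
    rw [(hderiv s hs').deriv]
    have e1 : -(κ' + θ * F s) / (a + θ * F s) + 1 = (a - κ') / (a + θ * F s) := by
      field_simp
      ring
    rw [e1]
    exact div_nonpos_of_nonpos_of_nonneg (by linarith) hp.le

/-- **A FINITE FLUID CANNOT OUTLIVE `1∕μ`.**  In the setting of `inv_rate_add_id_antitoneOn`, for `t ≤ s` in `[0, X]`: `μ(t)·(s − t) < 1`,
`μ(t) = (a + θF(t))∕(D₀ − κ't)` — so a discrete member of load `h = s − t` charged at (at most) the fluid's rate at the start of its step has ratio `< 1`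
automatically. [folklore] -/
theorem rate_mul_sub_lt_one {F : ℝ → ℝ} {a θ κ' D0 X : ℝ} (haκ : a ≤ κ')
    (hpos : ∀ s ∈ Icc (0:ℝ) X, 0 < a + θ * F s) (hD : ∀ s ∈ Icc (0:ℝ) X, 0 < D0 - κ' * s)
    (hF : ∀ s ∈ Icc (0:ℝ) X, HasDerivAt F (F s * (a + θ * F s) / (D0 - κ' * s)) s)
    {t s : ℝ} (ht : t ∈ Icc (0:ℝ) X) (hs : s ∈ Icc (0:ℝ) X) (hts : t ≤ s) :
    (a + θ * F t) / (D0 - κ' * t) * (s - t) < 1 := by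
  have hmono := inv_rate_add_id_antitoneOn haκ hpos hD hF ht hs hts
  simp only at hmono
  have h1 : 0 < (D0 - κ' * s) / (a + θ * F s) := div_pos (hD s hs) (hpos s hs)
  have h2 : s - t < (D0 - κ' * t) / (a + θ * F t) := by linarith
  have h3 : (a + θ * F t) * (s - t) < D0 - κ' * t := by
    calc (a + θ * F t) * (s - t) < (a + θ * F t) * ((D0 - κ' * t) / (a + θ * F t)) := mul_lt_mul_of_pos_left h2 (hpos t ht)
      _ = D0 - κ' * t := by rw [← mul_div_assoc, mul_div_cancel_left₀ _ (hpos t ht).ne']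
  rw [div_mul_eq_mul_div, div_lt_one (hD t ht)]
  exact h3

/-- **LOWER BOUND ON THE RATE INSIDE A STEP.**  In the same setting, for `t ≤ s` in `[0, X]`: `μ(s)·(1 − μ(t)(s − t)) ≥ μ(t)`, i.e.
`μ(s) ≥ μ(t)∕(1 − μ(t)(s−t))` — the fluid's rate grows at least like the solution of `y' = y²` started at `μ(t)`. [folklore] -/
theorem rate_lower_bound {F : ℝ → ℝ} {a θ κ' D0 X : ℝ} (haκ : a ≤ κ')
    (hpos : ∀ s ∈ Icc (0:ℝ) X, 0 < a + θ * F s) (hD : ∀ s ∈ Icc (0:ℝ) X, 0 < D0 - κ' * s)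
    (hF : ∀ s ∈ Icc (0:ℝ) X, HasDerivAt F (F s * (a + θ * F s) / (D0 - κ' * s)) s)
    {t s : ℝ} (ht : t ∈ Icc (0:ℝ) X) (hs : s ∈ Icc (0:ℝ) X) (hts : t ≤ s) :
    (a + θ * F t) / (D0 - κ' * t) ≤
      (a + θ * F s) / (D0 - κ' * s) * (1 - (a + θ * F t) / (D0 - κ' * t) * (s - t)) := by
  have hmono := inv_rate_add_id_antitoneOn haκ hpos hD hF ht hs hts
  simp only at hmono
  have hPt := hpos t ht
  have hPs := hpos s hs
  have hQt := hD t ht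
  have hQs := hD s hs
  -- from `Q s∕P s ≤ Q t∕P t − (s − t)`: `Q s·P t ≤ P s·(Q t − P t(s−t))`
  have key : (D0 - κ' * s) * (a + θ * F t) ≤ (a + θ * F s) * ((D0 - κ' * t) - (a + θ * F t) * (s - t)) := by
    have h1 : (D0 - κ' * s) / (a + θ * F s) ≤ (D0 - κ' * t) / (a + θ * F t) - (s - t) := by linarith
    rw [div_le_iff₀ hPs] at h1
    have e2 : ((D0 - κ' * t) / (a + θ * F t) - (s - t)) * (a + θ * F s) * (a + θ * F t) =
        (a + θ * F s) * ((D0 - κ' * t) - (a + θ * F t) * (s - t)) := by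
      field_simp
    calc (D0 - κ' * s) * (a + θ * F t) ≤ ((D0 - κ' * t) / (a + θ * F t) - (s - t)) * (a + θ * F s) * (a + θ * F t) :=
          mul_le_mul_of_nonneg_right h1 hPt.le
      _ = (a + θ * F s) * ((D0 - κ' * t) - (a + θ * F t) * (s - t)) := e2
  have e1 : (a + θ * F s) / (D0 - κ' * s) * (1 - (a + θ * F t) / (D0 - κ' * t) * (s - t)) =
      (a + θ * F s) * ((D0 - κ' * t) - (a + θ * F t) * (s - t)) / ((D0 - κ' * s) * (D0 - κ' * t)) := by
    field_simp
  rw [e1, div_le_div_iff₀ hQt (mul_pos hQs hQt)]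
  nlinarith [mul_le_mul_of_nonneg_right key hQt.le]

/-! ## §2 One-step domination -/

/-- **ONE-STEP DOMINATION.**  In the setting of §1 with `F > 0` on `[0, X]`, for `t ≤ s` in `[0, X]`:
**`F(t) ≤ F(s)·(1 − μ(t)(s − t))`**, i.e. `F(s)∕F(t) ≥ 1∕(1 − hμ(t))` with `h = s − t` — over a member's load the fluid compounds AT LEAST like one atom of
that load charged at the rate of the START of the step (proof: `u ↦ F(u)(1 − μ(t)(u − t))` has derivative `F(u)[μ(u)(1 − μ(t)(u−t)) − μ(t)] ≥ 0` by
`rate_lower_bound`). [folklore] -/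
theorem fluid_step {F : ℝ → ℝ} {a θ κ' D0 X : ℝ} (haκ : a ≤ κ')
    (hpos : ∀ s ∈ Icc (0:ℝ) X, 0 < a + θ * F s) (hD : ∀ s ∈ Icc (0:ℝ) X, 0 < D0 - κ' * s)
    (hF : ∀ s ∈ Icc (0:ℝ) X, HasDerivAt F (F s * (a + θ * F s) / (D0 - κ' * s)) s)
    (hFpos : ∀ s ∈ Icc (0:ℝ) X, 0 < F s)
    {t s : ℝ} (ht : t ∈ Icc (0:ℝ) X) (hs : s ∈ Icc (0:ℝ) X) (hts : t ≤ s) :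
    F t ≤ F s * (1 - (a + θ * F t) / (D0 - κ' * t) * (s - t)) := by
  have hsub : Icc t X ⊆ Icc (0:ℝ) X := Icc_subset_Icc ht.1 le_rfl
  have hderiv : ∀ u ∈ Icc t X, HasDerivAt (fun v => F v * (1 - (a + θ * F t) / (D0 - κ' * t) * (v - t)))
      (F u * (a + θ * F u) / (D0 - κ' * u) * (1 - (a + θ * F t) / (D0 - κ' * t) * (u - t)) +
        F u * (-((a + θ * F t) / (D0 - κ' * t)))) u := by
    intro u hu
    have h1 : HasDerivAt (fun v : ℝ => 1 - (a + θ * F t) / (D0 - κ' * t) * (v - t)) (-((a + θ * F t) / (D0 - κ' * t))) u := by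
      simpa using (((hasDerivAt_id u).sub_const t).const_mul ((a + θ * F t) / (D0 - κ' * t))).const_sub 1
    exact (hF u (hsub hu)).mul h1
  have hmono : MonotoneOn (fun v => F v * (1 - (a + θ * F t) / (D0 - κ' * t) * (v - t))) (Icc t X) := by
    refine monotoneOn_of_deriv_nonneg (convex_Icc t X) ?_ ?_ ?_
    · exact fun u hu => (hderiv u hu).continuousAt.continuousWithinAt
    · rw [interior_Icc]
      exact fun u hu => (hderiv u (Ioo_subset_Icc_self hu)).differentiableAt.differentiableWithinAt
    · rw [interior_Icc]
      intro u hu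
      have hu' : u ∈ Icc t X := Ioo_subset_Icc_self hu
      rw [(hderiv u hu').deriv]
      have hlow := rate_lower_bound haκ hpos hD hF ht (hsub hu') hu'.1
      have hFu := hFpos u (hsub hu')
      have e1 : F u * (a + θ * F u) / (D0 - κ' * u) * (1 - (a + θ * F t) / (D0 - κ' * t) * (u - t)) +
          F u * (-((a + θ * F t) / (D0 - κ' * t))) =
          F u * ((a + θ * F u) / (D0 - κ' * u) * (1 - (a + θ * F t) / (D0 - κ' * t) * (u - t)) -
            (a + θ * F t) / (D0 - κ' * t)) := by ring
      rw [e1]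
      exact mul_nonneg hFu.le (by linarith)
  have h := hmono (left_mem_Icc.mpr (ht.2.trans le_rfl |> fun h => hts.trans hs.2)) ⟨hts, hs.2⟩ hts
  simpa using h

/-! ## §3 The discrete spike is dominated by the fluid -/

/-- consumed loads are non-decreasing: `t_m ≤ t_n` for `m ≤ n` when `t_{m+1} = t_m + h_m`, `h ≥ 0`. [folklore] -/
theorem consumed_mono {h t : ℕ → ℝ} (hh : ∀ m, 0 ≤ h m) (ht : ∀ m, t (m + 1) = t m + h m) {m n : ℕ} (hmn : m ≤ n) :
    t m ≤ t n := by
  induction n with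
  | zero => rw [Nat.le_zero.mp hmn]
  | succ n ih =>
    rcases Nat.of_le_succ hmn with h1 | h1
    · exact (ih h1).trans (by rw [ht n]; linarith [hh n])
    · rw [h1]

/-- **THE DISCRETE SPIKE IS DOMINATED BY THE FLUID — (S2) WITH THE ATOM CORRECTION.**  DATA: a fluid `F > 0` on `[0, X]` solving
`F' = F(a + θF)∕(D₀ − κ's)` with positive rate (`a + θF > 0`, `D₀ − κ's > 0`) and **`κ' ≥ a`**; a discrete spike with member loads `h_m ≥ 0`, consumed loads
`t_{m+1} = t_m + h_m`, `t_0 ≥ 0`, `t_M ≤ X`, compounding `E_{m+1} = E_m∕(1 − ρ_m)`, `0 < E_0 ≤ F(t_0)`, and KEY ratios obeying the constant-coefficient step inequality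
`ρ_m ≤ h_m·(a + θE_m)∕(D₀ − κt_m)` (no sign condition on `ρ_m` is needed) with `0 ≤ θ` and a denominator slope `κ ≤ κ'`.  CONCLUSION: for every `m ≤ M`, **`0 < E_m ≤ F(t_m)`**, and for every
`m < M`, **`ρ_m < 1`** — the spike closes wherever the fluid lives, with no closure hypothesis on the discrete side.  (Induction: `ρ_m ≤ h_mμ_d ≤ h_mμ(t_m) < 1` by
`rate_mul_sub_lt_one`, then `E_{m+1} ≤ F(t_m)∕(1 − h_mμ(t_m)) ≤ F(t_{m+1})` by `fluid_step`.)  USE (README `g63/e72` §5): inside a spike the real static chain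
satisfies the step inequality with `a = 1 − θ̄(1)`, `θ = θ̄(1) + Λ`, `κ = √2·2(√2−1)`, `D₀ = 1 − √2W_far` (§4 `spike_step_le` + (E72a)'s majorant principle), and
`κ = 1.17 > a = 0.21`, so the worst-constant fluid dominates every discrete spike outright; a chain presented with `κ < a` is dominated by the fluid with
`κ' = a`. [folklore] -/
theorem spike_le_fluid {F : ℝ → ℝ} {a θ κ κ' D0 X : ℝ} {h t E ρ : ℕ → ℝ} {M : ℕ}
    (hθ : 0 ≤ θ) (hκκ' : κ ≤ κ') (haκ : a ≤ κ')
    (hpos : ∀ s ∈ Icc (0:ℝ) X, 0 < a + θ * F s) (hD : ∀ s ∈ Icc (0:ℝ) X, 0 < D0 - κ' * s)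
    (hF : ∀ s ∈ Icc (0:ℝ) X, HasDerivAt F (F s * (a + θ * F s) / (D0 - κ' * s)) s)
    (hFpos : ∀ s ∈ Icc (0:ℝ) X, 0 < F s)
    (hh : ∀ m, 0 ≤ h m) (ht0 : 0 ≤ t 0) (ht : ∀ m, t (m + 1) = t m + h m) (htM : t M ≤ X)
    (hE0 : 0 < E 0) (hEF : E 0 ≤ F (t 0)) (hE : ∀ m, E (m + 1) = E m / (1 - ρ m))
    (hρ : ∀ m, m < M → ρ m ≤ h m * ((a + θ * E m) / (D0 - κ * t m))) :
    ∀ m, m ≤ M → (0 < E m ∧ E m ≤ F (t m)) ∧ (m < M → ρ m < 1) := by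
  have htI : ∀ m, m ≤ M → t m ∈ Icc (0:ℝ) X := fun m hm =>
    ⟨ht0.trans (consumed_mono hh ht (Nat.zero_le m)), (consumed_mono hh ht hm).trans htM⟩
  -- ONE STEP: from the bound at `m < M` to `ρ_m < 1` and the bound at `m + 1`
  have step : ∀ m, m < M → 0 < E m → E m ≤ F (t m) →
      ρ m < 1 ∧ 0 < E (m + 1) ∧ E (m + 1) ≤ F (t (m + 1)) := by
    intro m hm hEm hEmF
    have htm := htI m hm.le
    have htm1 := htI (m + 1) hm
    have hts : t m ≤ t (m + 1) := by rw [ht]; linarith [hh m]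
    have hQ' := hD (t m) htm
    have hQ : D0 - κ' * t m ≤ D0 - κ * t m := by nlinarith [htm.1]
    have hμd : (a + θ * E m) / (D0 - κ * t m) ≤ (a + θ * F (t m)) / (D0 - κ' * t m) :=
      div_le_div₀ (hpos _ htm).le (by nlinarith [mul_le_mul_of_nonneg_left hEmF hθ]) hQ' hQ
    have hlt : (a + θ * F (t m)) / (D0 - κ' * t m) * h m < 1 := by
      have h1 := rate_mul_sub_lt_one haκ hpos hD hF htm htm1 hts
      rwa [ht m, add_sub_cancel_left] at h1
    have hρ1 : ρ m ≤ (a + θ * F (t m)) / (D0 - κ' * t m) * h m :=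
      (hρ m hm).trans (by rw [mul_comm]; exact mul_le_mul_of_nonneg_right hμd (hh m))
    have hρlt : ρ m < 1 := lt_of_le_of_lt hρ1 hlt
    have h1ρ : 0 < 1 - ρ m := by linarith
    have h1μ : 0 < 1 - (a + θ * F (t m)) / (D0 - κ' * t m) * h m := by linarith
    refine ⟨hρlt, ?_, ?_⟩
    · rw [hE m]; exact div_pos hEm h1ρ
    · have hstep := fluid_step haκ hpos hD hF hFpos htm htm1 hts
      rw [ht m, add_sub_cancel_left] at hstep
      rw [hE m, ht m]
      calc E m / (1 - ρ m) ≤ F (t m) / (1 - (a + θ * F (t m)) / (D0 - κ' * t m) * h m) :=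
            div_le_div₀ (hFpos _ htm).le hEmF h1μ (by linarith)
        _ ≤ F (t m + h m) := by rw [div_le_iff₀ h1μ]; exact hstep
  intro m
  induction m with
  | zero => intro _; exact ⟨⟨hE0, hEF⟩, fun hM => (step 0 hM hE0 hEF).1⟩
  | succ m ih =>
    intro hm
    have hm' : m < M := Nat.lt_of_succ_le hm
    obtain ⟨⟨hEm, hEmF⟩, _⟩ := ih hm'.le
    have hs := step m hm' hEm hEmF
    exact ⟨⟨hs.2.1, hs.2.2⟩, fun hm1 => (step (m + 1) hm1 hs.2.1 hs.2.2).1⟩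

/-! ## §4 The step inequality of a spike member, from the structure of the static chain -/

/-- **THE SPIKE STEP INEQUALITY.**  A member `m` of a dense cluster in the static chain: KEY ratio `ρ_m = x_m(1 + L^far_m + Σ_{i<m} θ_{m,i}·ρ_i·Π_{i≤j<m}(1−ρ_j)⁻¹)∕
(1 − Ω_m)` ((E72a) `beta_closed_form` for the near carried ratios), mutual defects `0 ≤ θ_{m,i} ≤ θ ≤ 1`, older ratios in `[0,1)`, the FAR load it sees COMPOUNDED by
the older members and bounded by `Λ·E_m` (`E_m = Π_{j<m}(1−ρ_j)⁻¹`; `Λ ≥ 0` = the far load seen at the split with the oldest member's defects — (E72b) `load_split`'s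
factorisation), and window mass `1 − Ω_m ≥ D₀ − κt_m > 0` (`Ω_m ≤ √2(W_far + c·t_m)`).  Then **`ρ_m ≤ x_m·((1 − θ) + (θ + Λ)·E_m)∕(D₀ − κt_m)`** — the constant-coefficient
step inequality of `spike_le_fluid` with `a = 1 − θ`, `θ ← θ + Λ` (by (E72a) `sum_rho_mul_compounding`: the near load is `≤ θ(E_m − 1)`). [folklore] -/
theorem spike_step_le {x ρ Lfar Ω t : ℕ → ℝ} {θm : ℕ → ℕ → ℝ} {θ Λ D0 κ : ℝ} {m : ℕ}
    (hρm : ρ m = x m * (1 + Lfar m + ∑ i ∈ range m, θm m i * (ρ i * ∏ j ∈ Ico i m, (1 - ρ j)⁻¹)) / (1 - Ω m))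
    (hx : 0 ≤ x m) (hρ0 : ∀ j, j < m → 0 ≤ ρ j) (hρ1 : ∀ j, j < m → ρ j < 1)
    (hθm : ∀ i, i < m → 0 ≤ θm m i ∧ θm m i ≤ θ) (hθ0 : 0 ≤ θ) (hθ1 : θ ≤ 1) (hΛ : 0 ≤ Λ)
    (hfar : Lfar m ≤ Λ * ∏ j ∈ range m, (1 - ρ j)⁻¹) (hΩ : D0 - κ * t m ≤ 1 - Ω m) (hDen : 0 < D0 - κ * t m) :
    ρ m ≤ x m * (((1 - θ) + (θ + Λ) * ∏ j ∈ range m, (1 - ρ j)⁻¹) / (D0 - κ * t m)) := by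
  have hinv : ∀ j, j < m → 1 ≤ (1 - ρ j)⁻¹ := fun j hj => by
    rw [le_inv_comm₀ one_pos (by linarith [hρ1 j hj]), inv_one]; linarith [hρ0 j hj]
  have hE1 : 1 ≤ ∏ j ∈ range m, (1 - ρ j)⁻¹ := by
    calc (1:ℝ) = ∏ j ∈ range m, (1:ℝ) := by simp
      _ ≤ ∏ j ∈ range m, (1 - ρ j)⁻¹ := prod_le_prod (fun j _ => zero_le_one) fun j hj => hinv j (mem_range.mp hj)
  have hw : ∀ i ∈ range m, 0 ≤ ρ i * ∏ j ∈ Ico i m, (1 - ρ j)⁻¹ := fun i hi =>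
    mul_nonneg (hρ0 i (mem_range.mp hi))
      (prod_nonneg fun j hj => le_trans zero_le_one (hinv j (mem_Ico.mp hj).2))
  have hnear : ∑ i ∈ range m, θm m i * (ρ i * ∏ j ∈ Ico i m, (1 - ρ j)⁻¹) ≤ θ * ((∏ j ∈ range m, (1 - ρ j)⁻¹) - 1) := by
    rw [← sum_rho_mul_compounding (fun j hj => (hρ1 j hj).ne), mul_sum]
    exact sum_le_sum fun i hi => mul_le_mul_of_nonneg_right (hθm i (mem_range.mp hi)).2 (hw i hi)
  have hnum : 1 + Lfar m + ∑ i ∈ range m, θm m i * (ρ i * ∏ j ∈ Ico i m, (1 - ρ j)⁻¹) ≤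
      (1 - θ) + (θ + Λ) * ∏ j ∈ range m, (1 - ρ j)⁻¹ := by nlinarith
  have hnum0 : 0 ≤ (1 - θ) + (θ + Λ) * ∏ j ∈ range m, (1 - ρ j)⁻¹ := by
    nlinarith [mul_nonneg (add_nonneg hθ0 hΛ) (zero_le_one.trans hE1)]
  rw [hρm, mul_div_assoc]
  exact mul_le_mul_of_nonneg_left (div_le_div₀ hnum0 hnum hDen hΩ) hx

/-- The compounding as a recursion: `Π_{j<m+1}(1−ρ_j)⁻¹ = (Π_{j<m}(1−ρ_j)⁻¹)∕(1 − ρ_m)` (the `hE` hypothesis of `spike_le_fluid` for `E_m = Π_{j<m}(1−ρ_j)⁻¹`). [folklore] -/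
theorem compounding_succ (ρ : ℕ → ℝ) (m : ℕ) :
    ∏ j ∈ range (m + 1), (1 - ρ j)⁻¹ = (∏ j ∈ range m, (1 - ρ j)⁻¹) / (1 - ρ m) := by
  rw [prod_range_succ, div_eq_mul_inv]

/-! ## §5 The explicit bound: the discrete spike under (E72e)'s closed form -/

/-- monotonicity of the closed form's `q`: for `0 ≤ a∕κ'`-type exponents, `q(s) ≤ q(X)` when `0 ≤ s ≤ X` and `D₀ − κ'X > 0`, `κ' ≥ 0`. [folklore] -/
theorem q_mono {a θ κ' D0 s X : ℝ} (ha : 0 ≤ a) (hκ' : 0 ≤ κ') (haθ : 0 < a + θ) (hsX : s ≤ X) (hDX : 0 < D0 - κ' * X) :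
    Real.exp (a / κ' * (Real.log D0 - Real.log (D0 - κ' * s))) / (a + θ) ≤
      Real.exp (a / κ' * (Real.log D0 - Real.log (D0 - κ' * X))) / (a + θ) := by
  have hDs : D0 - κ' * X ≤ D0 - κ' * s := by nlinarith
  have hlog : Real.log (D0 - κ' * X) ≤ Real.log (D0 - κ' * s) := Real.log_le_log hDX hDs
  exact div_le_div_of_nonneg_right
    (Real.exp_le_exp.mpr (mul_le_mul_of_nonneg_left (by linarith) (div_nonneg ha hκ'))) haθ.le

/-- **THE EXPLICIT (S2).**  A discrete spike (`h_m ≥ 0`, `t_0 = 0`, `t_{m+1} = t_m + h_m`, `E_0 = 1`, `E_{m+1} = E_m∕(1−ρ_m)`,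
`ρ_m ≤ h_m(a + θE_m)∕(D₀ − κt_m)`) with `0 < a ≤ κ'`, `0 ≤ θ`, `κ ≤ κ'`, and (E72e)'s closed form alive up to the consumed load `t_M`
(`D₀ − κ't_M > 0`, `θ·q(t_M) < 1`, `q(t) = e^{(a∕κ')(log D₀ − log(D₀ − κ't))}∕(a + θ)`): for every `m ≤ M`,
**`E_m ≤ a·q(t_m)∕(1 − θ·q(t_m))`** and (`m < M`) **`ρ_m < 1`**.  With `a = 1 − θ̄(1)`, `θ = θ̄(1) + Λ`, `κ = κ' = √2·2(√2−1)`, `D₀ = 1 − √2W_far` this is the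
worst-constant fluid bound on every discrete spike of README `g63/e72` §5, unconditionally. [folklore] -/
theorem spike_le_closed_form {a θ κ κ' D0 : ℝ} {h t E ρ : ℕ → ℝ} {M : ℕ}
    (ha : 0 < a) (haκ : a ≤ κ') (hθ : 0 ≤ θ) (hκκ' : κ ≤ κ')
    (hh : ∀ m, 0 ≤ h m) (ht0 : t 0 = 0) (ht : ∀ m, t (m + 1) = t m + h m)
    (hE0 : E 0 = 1) (hE : ∀ m, E (m + 1) = E m / (1 - ρ m))
    (hρ : ∀ m, m < M → ρ m ≤ h m * ((a + θ * E m) / (D0 - κ * t m)))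
    (hDM : 0 < D0 - κ' * t M)
    (hqM : θ * (Real.exp (a / κ' * (Real.log D0 - Real.log (D0 - κ' * t M))) / (a + θ)) < 1) :
    ∀ m, m ≤ M →
      E m ≤ a * (Real.exp (a / κ' * (Real.log D0 - Real.log (D0 - κ' * t m))) / (a + θ)) /
          (1 - θ * (Real.exp (a / κ' * (Real.log D0 - Real.log (D0 - κ' * t m))) / (a + θ))) ∧
      (m < M → ρ m < 1) := by
  have hκ'0 : 0 < κ' := lt_of_lt_of_le ha haκ
  have haθ : 0 < a + θ := by linarith
  -- the closed form's hypotheses hold on the whole interval `[0, t_M]`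
  have hD : ∀ s ∈ Icc (0:ℝ) (t M), 0 < D0 - κ' * s := fun s hs => by nlinarith [hs.2]
  have hq1 : ∀ s ∈ Icc (0:ℝ) (t M), θ * (Real.exp (a / κ' * (Real.log D0 - Real.log (D0 - κ' * s))) / (a + θ)) < 1 :=
    fun s hs => lt_of_le_of_lt (mul_le_mul_of_nonneg_left (q_mono ha.le hκ'0.le haθ hs.2 hDM) hθ) hqM
  have hqpos : ∀ s : ℝ, 0 < Real.exp (a / κ' * (Real.log D0 - Real.log (D0 - κ' * s))) / (a + θ) :=
    fun s => div_pos (Real.exp_pos _) haθ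
  have hFpos : ∀ s ∈ Icc (0:ℝ) (t M), 0 < a * (Real.exp (a / κ' * (Real.log D0 - Real.log (D0 - κ' * s))) / (a + θ)) /
      (1 - θ * (Real.exp (a / κ' * (Real.log D0 - Real.log (D0 - κ' * s))) / (a + θ))) :=
    fun s hs => div_pos (mul_pos ha (hqpos s)) (by linarith [hq1 s hs])
  have hpos : ∀ s ∈ Icc (0:ℝ) (t M), 0 < a + θ * (a * (Real.exp (a / κ' * (Real.log D0 - Real.log (D0 - κ' * s))) / (a + θ)) /
      (1 - θ * (Real.exp (a / κ' * (Real.log D0 - Real.log (D0 - κ' * s))) / (a + θ)))) :=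
    fun s hs => by have := hFpos s hs; positivity
  have hF := fun s (hs : s ∈ Icc (0:ℝ) (t M)) => hasDerivAt_spike_closed_form (a := a) (θ := θ) hκ'0.ne' (hD s hs) (hq1 s hs)
  have hmain := spike_le_fluid (M := M)
    (F := fun s => a * (Real.exp (a / κ' * (Real.log D0 - Real.log (D0 - κ' * s))) / (a + θ)) /
      (1 - θ * (Real.exp (a / κ' * (Real.log D0 - Real.log (D0 - κ' * s))) / (a + θ))))
    hθ hκκ' haκ hpos hD hF hFpos hh (le_of_eq ht0.symm) ht le_rfl (by rw [hE0]; exact one_pos)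
    (by rw [hE0, ht0]; exact (spike_closed_form_zero (κ := κ') (D0 := D0) ha hθ).symm.le) hE hρ
  intro m hm
  exact ⟨(hmain m hm).1.2, (hmain m hm).2⟩

end Summit.QuantumFields.BalabanUV.Beta.EriceRemainderEnclosureHistoryAutonomyComparisonAgeCompositionStaticChainFluidDomination

end
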